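import Summits.NavierStokesRegularity.NavierStokesRegularity.Theorems.AxisTwistDoorAveragedConeLiouvilleNUWeakEnergyTools
import HarnessLib

/-!
# N4 / T1 piece W1, brick B1: the Lipschitz time-slab cutoff `χ_h` and the slab weight `η·χ_h`

Route `AxisTwistDoor`, crux `AveragedConeLiouville` (stmt-NavierStokesRegularity-26889), INPUT N4 / T1,
programme `kits/N4-T1-skeleton.lean` (118454bf17607d1e), `kits/N4-T1-plan.md` v2 §7 brick (B1).
For `t₁ ≤ t₂` and `0 < h` the piecewise-linear plateau `χ_h` (`0` on `]−∞,t₁−h]`, linear up on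
`[t₁−h,t₁]`, `1` on `[t₁,t₂]`, linear down on `[t₂,t₂+h]`, `0` after) is `h⁻¹`-Lipschitz with values
in `[0,1]` and has the explicit derivative `h⁻¹𝟙_{]t₁−h,t₁[} − h⁻¹𝟙_{]t₂,t₂+h[}` off the four kinks
(`exists_slab_cutoff`); for `η ∈ C¹` the slab weight `c = η·χ_h` is globally Lipschitz
(`exists_lipschitzWith_slab_weight`) with `c′ = η′χ_h + ηχ_h′` off the kinks, hence a.e.
(`hasDerivAt_slab_weight`, `deriv_slab_weight_ae`). These are the time weights fed to W1a
(`nu_weakEnergy_timeWeighted`) in bricks B4/B5.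

WHAT THIS IS NOT: not a statement about Navier–Stokes; T1 is an INPUT; item 26889 and the summit
stay open. [folklore]
-/

noncomputable section

-- the summit and its single sub-problem share the name (CONVENTIONS §1)
set_option linter.dupNamespace false

open MeasureTheory Set Function Filter Topology Metric
open scoped NNReal ENNReal

namespace Summit.NavierStokesRegularity.NavierStokesRegularity.Theorems.AveragedConeLiouville.NUPositivity

/-- **The Lipschitz time-slab cutoff `χ_h`.** [folklore] -/
theorem exists_slab_cutoff {t₁ t₂ h : ℝ} (h12 : t₁ ≤ t₂) (hh : 0 < h) :
    ∃ χ : ℝ → ℝ, LipschitzWith (Real.toNNReal h⁻¹) χ ∧ (∀ t, 0 ≤ χ t ∧ χ t ≤ 1) ∧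
      (∀ t, t ≤ t₁ - h → χ t = 0) ∧ (∀ t, t₂ + h ≤ t → χ t = 0) ∧ (∀ t ∈ Icc t₁ t₂, χ t = 1) ∧
      (∀ t ∈ Icc (t₁ - h) t₁, χ t = (t - (t₁ - h)) / h) ∧
      (∀ t ∈ Icc t₂ (t₂ + h), χ t = (t₂ + h - t) / h) ∧
      (∀ t, t ≠ t₁ - h → t ≠ t₁ → t ≠ t₂ → t ≠ t₂ + h →
        HasDerivAt χ (h⁻¹ * (Ioo (t₁ - h) t₁).indicator 1 t - h⁻¹ * (Ioo t₂ (t₂ + h)).indicator 1 t) t) := by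
  set A : ℝ → ℝ := fun t => (t - (t₁ - h)) / h with hA
  set B : ℝ → ℝ := fun t => (t₂ + h - t) / h with hB
  set χ : ℝ → ℝ := fun t => max 0 (min 1 (min (A t) (B t))) with hχ
  have hcoe : ((Real.toNNReal h⁻¹ : ℝ≥0) : ℝ) = h⁻¹ := Real.coe_toNNReal _ (inv_nonneg.2 hh.le)
  have hAl : LipschitzWith (Real.toNNReal h⁻¹) A := by
    refine LipschitzWith.of_dist_le_mul fun x y => ?_
    rw [Real.dist_eq, Real.dist_eq, hcoe, hA]
    have : (x - (t₁ - h)) / h - (y - (t₁ - h)) / h = (x - y) / h := by ring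
    rw [this, abs_div, abs_of_pos hh, div_eq_inv_mul]
  have hBl : LipschitzWith (Real.toNNReal h⁻¹) B := by
    refine LipschitzWith.of_dist_le_mul fun x y => ?_
    rw [Real.dist_eq, Real.dist_eq, hcoe, hB]
    have : (t₂ + h - x) / h - (t₂ + h - y) / h = -((x - y) / h) := by ring
    rw [this, abs_neg, abs_div, abs_of_pos hh, div_eq_inv_mul]
  have hχl : LipschitzWith (Real.toNNReal h⁻¹) χ := by
    have := ((hAl.min hBl).const_min 1).const_max 0
    simpa [max_self] using this
  -- values
  have hA_up : ∀ t ∈ Icc (t₁ - h) t₁, 0 ≤ A t ∧ A t ≤ 1 ∧ A t ≤ B t := by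
    intro t ht
    refine ⟨div_nonneg (by linarith [ht.1]) hh.le, (div_le_one hh).2 (by linarith [ht.2]), ?_⟩
    exact div_le_div_of_nonneg_right (by linarith [ht.2]) hh.le
  have hB_dn : ∀ t ∈ Icc t₂ (t₂ + h), 0 ≤ B t ∧ B t ≤ 1 ∧ B t ≤ A t := by
    intro t ht
    refine ⟨div_nonneg (by linarith [ht.2]) hh.le, (div_le_one hh).2 (by linarith [ht.1]), ?_⟩
    exact div_le_div_of_nonneg_right (by linarith [ht.1]) hh.le
  have hup : ∀ t ∈ Icc (t₁ - h) t₁, χ t = (t - (t₁ - h)) / h := by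
    intro t ht
    obtain ⟨h0, h1, hab⟩ := hA_up t ht
    simp only [hχ]
    rw [min_eq_left hab, min_eq_right h1, max_eq_right h0]
  have hdn : ∀ t ∈ Icc t₂ (t₂ + h), χ t = (t₂ + h - t) / h := by
    intro t ht
    obtain ⟨h0, h1, hba⟩ := hB_dn t ht
    simp only [hχ]
    rw [min_eq_right hba, min_eq_right h1, max_eq_right h0]
  have hone : ∀ t ∈ Icc t₁ t₂, χ t = 1 := by
    intro t ht
    have hA1 : 1 ≤ A t := (one_le_div hh).2 (by linarith [ht.1])
    have hB1 : 1 ≤ B t := (one_le_div hh).2 (by linarith [ht.2])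
    simp only [hχ]
    rw [min_eq_left (le_min hA1 hB1), max_eq_right zero_le_one]
  have hzl : ∀ t, t ≤ t₁ - h → χ t = 0 := by
    intro t ht
    have hA0 : A t ≤ 0 := div_nonpos_of_nonpos_of_nonneg (by linarith) hh.le
    simp only [hχ]
    exact max_eq_left (((min_le_right _ _).trans (min_le_left _ _)).trans hA0)
  have hzr : ∀ t, t₂ + h ≤ t → χ t = 0 := by
    intro t ht
    have hB0 : B t ≤ 0 := div_nonpos_of_nonpos_of_nonneg (by linarith) hh.le
    simp only [hχ]
    exact max_eq_left (((min_le_right _ _).trans (min_le_right _ _)).trans hB0)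
  refine ⟨χ, hχl, fun t => ⟨le_max_left _ _, max_le zero_le_one (min_le_left _ _)⟩, hzl, hzr, hone,
    hup, hdn, fun t hn1 hn2 hn3 hn4 => ?_⟩
  -- derivative off the kinks: five open regions
  have hdA : HasDerivAt A h⁻¹ t := by
    have := ((hasDerivAt_id t).sub_const (t₁ - h)).div_const h
    simpa [hA, one_div] using this
  have hdB : HasDerivAt B (-h⁻¹) t := by
    have := ((hasDerivAt_const t (t₂ + h)).sub (hasDerivAt_id t)).div_const h
    refine (this.congr_deriv ?_)
    simp [div_eq_mul_inv]
  by_cases h1 : t < t₁ - h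
  · have hev : χ =ᶠ[𝓝 t] fun _ => (0 : ℝ) := by
      filter_upwards [Iio_mem_nhds h1] with s hs using hzl s (le_of_lt hs)
    have hι1 : t ∉ Ioo (t₁ - h) t₁ := fun h' => by linarith [h'.1]
    have hι2 : t ∉ Ioo t₂ (t₂ + h) := fun h' => by linarith [h'.1]
    rw [indicator_of_notMem hι1, indicator_of_notMem hι2, mul_zero, sub_zero]
    exact (hasDerivAt_const t (0 : ℝ)).congr_of_eventuallyEq hev
  have h1' : t₁ - h < t := lt_of_le_of_ne (not_lt.mp h1) (Ne.symm hn1)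
  by_cases h2 : t < t₁
  · have hev : χ =ᶠ[𝓝 t] A := by
      filter_upwards [Ioo_mem_nhds h1' h2] with s hs using hup s (Ioo_subset_Icc_self hs)
    have hι1 : t ∈ Ioo (t₁ - h) t₁ := ⟨h1', h2⟩
    have hι2 : t ∉ Ioo t₂ (t₂ + h) := fun h' => by linarith [h'.1]
    rw [indicator_of_mem hι1, indicator_of_notMem hι2, Pi.one_apply, mul_one, mul_zero, sub_zero]
    exact hdA.congr_of_eventuallyEq hev
  have h2' : t₁ < t := lt_of_le_of_ne (not_lt.mp h2) (Ne.symm hn2)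
  by_cases h3 : t < t₂
  · have hev : χ =ᶠ[𝓝 t] fun _ => (1 : ℝ) := by
      filter_upwards [Ioo_mem_nhds h2' h3] with s hs using hone s (Ioo_subset_Icc_self hs)
    have hι1 : t ∉ Ioo (t₁ - h) t₁ := fun h' => by linarith [h'.2]
    have hι2 : t ∉ Ioo t₂ (t₂ + h) := fun h' => by linarith [h'.1]
    rw [indicator_of_notMem hι1, indicator_of_notMem hι2, mul_zero, sub_zero]
    exact (hasDerivAt_const t (1 : ℝ)).congr_of_eventuallyEq hev
  have h3' : t₂ < t := lt_of_le_of_ne (not_lt.mp h3) (Ne.symm hn3)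
  by_cases h4 : t < t₂ + h
  · have hev : χ =ᶠ[𝓝 t] B := by
      filter_upwards [Ioo_mem_nhds h3' h4] with s hs using hdn s (Ioo_subset_Icc_self hs)
    have hι1 : t ∉ Ioo (t₁ - h) t₁ := fun h' => by linarith [h'.2]
    have hι2 : t ∈ Ioo t₂ (t₂ + h) := ⟨h3', h4⟩
    rw [indicator_of_notMem hι1, indicator_of_mem hι2, Pi.one_apply, mul_zero, mul_one, zero_sub]
    exact hdB.congr_of_eventuallyEq hev
  have h4' : t₂ + h < t := lt_of_le_of_ne (not_lt.mp h4) (Ne.symm hn4)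
  have hev : χ =ᶠ[𝓝 t] fun _ => (0 : ℝ) := by
    filter_upwards [Ioi_mem_nhds h4'] with s hs using hzr s (le_of_lt hs)
  have hι1 : t ∉ Ioo (t₁ - h) t₁ := fun h' => by linarith [h'.2]
  have hι2 : t ∉ Ioo t₂ (t₂ + h) := fun h' => by linarith [h'.2]
  rw [indicator_of_notMem hι1, indicator_of_notMem hι2, mul_zero, sub_zero]
  exact (hasDerivAt_const t (0 : ℝ)).congr_of_eventuallyEq hev

/-- **The slab weight `η·χ` is globally Lipschitz** for `η ∈ C¹` and a Lipschitz `χ` with values in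
`[0,1]` vanishing off `[a,b]`. [folklore] -/
theorem exists_lipschitzWith_slab_weight {η : ℝ → ℝ} (hη : ContDiff ℝ 1 η) {χ : ℝ → ℝ} {K : ℝ≥0}
    (hχ : LipschitzWith K χ) (hχb : ∀ t, 0 ≤ χ t ∧ χ t ≤ 1) {a b : ℝ}
    (hχa : ∀ t, t ≤ a → χ t = 0) (hχb' : ∀ t, b ≤ t → χ t = 0) :
    ∃ K' : ℝ≥0, LipschitzWith K' fun t => η t * χ t := by
  -- `η` is Lipschitz and bounded on the compact interval `[a,b]`
  obtain ⟨C, hC⟩ := isCompact_Icc.exists_bound_of_continuousOn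
    ((hη.continuous_deriv le_rfl).continuousOn (s := Icc a b))
  obtain ⟨M, hM⟩ := isCompact_Icc.exists_bound_of_continuousOn (hη.continuous.continuousOn (s := Icc a b))
  have hηL : LipschitzOnWith (Real.toNNReal C) η (Icc a b) := by
    refine (convex_Icc a b).lipschitzOnWith_of_nnnorm_hasDerivWithin_le
      (fun x _ => ((hη.differentiable one_ne_zero) x).hasDerivAt.hasDerivWithinAt) fun x hx => ?_
    rw [← NNReal.coe_le_coe, coe_nnnorm, Real.coe_toNNReal', le_max_iff]
    exact Or.inl (hC x hx)
  have hχ0 : ∀ t, t ∉ Icc a b → χ t = 0 := by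
    intro t ht
    rcases not_and_or.mp (show ¬ (a ≤ t ∧ t ≤ b) from ht) with h | h
    · exact hχa t (le_of_lt (not_le.mp h))
    · exact hχb' t (le_of_lt (not_le.mp h))
  have hχ1 : ∀ t, |χ t| ≤ 1 := fun t => by
    rw [abs_of_nonneg (hχb t).1]; exact (hχb t).2
  have hM0 : 0 ≤ max M 0 := le_max_right _ _
  exact ⟨_, lipschitzWith_mul_of_eq_zero_off hχ hχ1 hχ0 hηL
    (fun x hx => ((Real.norm_eq_abs _).symm.le.trans (hM x hx)).trans (le_max_left _ _)) hM0 zero_le_one⟩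

/-- **Product rule for the slab weight off the kinks.** [folklore] -/
theorem hasDerivAt_slab_weight {η : ℝ → ℝ} (hη : ContDiff ℝ 1 η) {χ : ℝ → ℝ} {t d : ℝ}
    (hχ : HasDerivAt χ d t) :
    HasDerivAt (fun s => η s * χ s) (deriv η t * χ t + η t * d) t :=
  ((hη.differentiable one_ne_zero) t).hasDerivAt.mul hχ

/-- **The derivative of the slab weight, almost everywhere** (the kink set is finite). [folklore] -/
theorem deriv_slab_weight_ae {η : ℝ → ℝ} (hη : ContDiff ℝ 1 η) {χ dχ : ℝ → ℝ} {S : Set ℝ}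
    (hS : S.Finite) (hχ : ∀ t, t ∉ S → HasDerivAt χ (dχ t) t) :
    ∀ᵐ t ∂(volume : Measure ℝ), deriv (fun s => η s * χ s) t = deriv η t * χ t + η t * dχ t := by
  have hS0 : (volume : Measure ℝ) S = 0 := hS.measure_zero _
  filter_upwards [compl_mem_ae_iff.2 hS0] with t ht
  exact (hasDerivAt_slab_weight hη (hχ t ht)).deriv

end Summit.NavierStokesRegularity.NavierStokesRegularity.Theorems.AveragedConeLiouville.NUPositivity

end
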